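import Summits.Langlands.Langlands.Theorems.SoloInformedGLOneRationalField
import Literature.NumberTheory.GaloisRepresentations.DeRhamLAdicCharacterHeckeSplitPrime
import HarnessLib

/-!
# Λ44 — Rank-one Fontaine–Mazur for every number field at the totally split primes

Solo (informed) programme, rung Λ44.  Λ41 decided the repaired `GL₁` conjunct over `ℚ` via
Stage C's proof of Tate's theorem in degree one.  The same local theorem applies at every place
of degree one of ANY number field `K`, hence at every `v ∣ ℓ` when `ℓ` splits completely in `K`
(Literature `FramedGaloisRep.exists_heckeCharacter_of_isDeRhamFramed_of_splits`, Λ43).  Read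
through rigidity (Λ22 `eq_weilRep_of_eventually_hasFrobCharpolyAt`):

* ★★★ `fontaineMazurOne_of_splits` — **for every number field `K`, every reciprocity datum and
  every prime `ℓ` splitting completely in `K`: a continuous `ρ : Γ_K → GL₁(ℚ̄_ℓ)` that the pinned
  datum declares de Rham at every `v ∣ ℓ` IS Weil's `r_{θ,ι}` for an algebraic Hecke character
  `θ` of `K`** — the `ℓ`-instance of clause (B⁺)₁ / rank-one Fontaine–Mazur, unconditionally, at a
  set of primes of density `1/[K̃ : ℚ]` (Chebotarev).

What is NOT here: primes `ℓ` with a place `v ∣ ℓ` of degree `> 1` (Tate's theorem for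
`[K_v : ℚ_ℓ] > 1`, i.e. Sen's theorem for non-cyclotomic characters, is not in the tree).

Plain theorems; no definitions.

Citations: [FontaineMazurGeometric1995] Conj. 1; [Patrikis2019] Prop. 2.2.1;
[SerreAbelianLadic1968] Ch. III §2.3 Thm. 2 and App. A; [Tate1967] §3.3 Thm. 2; [Weil1956] §1.
-/

noncomputable section
open scoped MatrixGroups Matrix Classical Polynomial NumberField
open NumberField IsDedekindDomain Field Polynomial Filter
open Literature.NumberTheory.Automorphic Literature.NumberTheory.GaloisRepresentations
open Literature.NumberTheory.PAdicHodge

namespace Summit.Langlands.Langlands.Theorems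

namespace GLOneRigidity

section SplitPrime

variable {K : Type} [Field K] [NumberField K]

/-- ★★★ **Rank-one Fontaine–Mazur (pinned datum) for every number field at every totally split
prime, unconditionally**: if `ℓ` splits completely in `K` (`e(v|ℓ) = f(v|ℓ) = 1` for all `v ∣ ℓ`),
every continuous `ρ : Γ_K → GL₁(ℚ̄_ℓ)` de Rham at every `v ∣ ℓ` for the pinned Fontaine datum is
Weil's `r_{θ,ι}` for an algebraic Hecke character `θ` of `K`
(Λ43 `FramedGaloisRep.exists_heckeCharacter_of_isDeRhamFramed_of_splits` + Λ22 rigidity).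
[cite: FontaineMazurGeometric1995, Conj. 1] [cite: Patrikis2019, Prop. 2.2.1]
[cite: SerreAbelianLadic1968, Ch. III §2.3 Thm. 2 and App. A] -/
theorem fontaineMazurOne_of_splits (𝓡 : ReciprocityData K) {ℓ : ℕ} [Fact ℓ.Prime]
    (hsplit : ∀ v : HeightOneSpectrum (𝓞 K), ((ℓ : ℕ) : 𝓞 K) ∈ v.asIdeal →
      v.asIdeal.ramificationIdx (𝓞 ℚ) = 1 ∧ v.asIdeal.inertiaDeg (𝓞 ℚ) = 1)
    (ι : PadicAlgCl ℓ ≃+* ℂ) (ρ : FramedGaloisRep K (PadicAlgCl ℓ) 1)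
    (hdR : ∀ (v : HeightOneSpectrum (𝓞 K)) (hv : ((ℓ : ℕ) : 𝓞 K) ∈ v.asIdeal),
      (𝓡.pst ℓ v hv).IsDeRhamFramed (ρ.toLocal v)) :
    ∃ (θ : HeckeCharacter K) (p q : InfinitePlace K → ℤ) (hinf : θ.HasInfinityType p q)
      (T : Finset (HeightOneSpectrum (𝓞 K))) (e : HeightOneSpectrum (𝓞 K) → ℕ)
      (hmod : HeckeCharacter.IsModulus θ T e), ρ = hinf.weilRep hmod ι := by
  obtain ⟨χ, hχ, h⟩ := FramedGaloisRep.exists_heckeCharacter_of_isDeRhamFramed_of_splits K ℓ hsplit ρ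
    (fun v hv => hdR v hv) ι
  obtain ⟨p, q, hinf⟩ := χ.isAlgebraic_iff_exists_hasInfinityType.mp hχ
  obtain ⟨T, e, hmod⟩ := χ.exists_isModulus
  exact ⟨χ, p, q, hinf, T, e, hmod,
    eq_weilRep_of_eventually_hasFrobCharpolyAt ι hinf hmod (h.mono fun v hv => hv.2.2)⟩

/-- **… without the datum wrapper**: the same statement for the Literature-side pinned datum
`fontainePstAdicCompletion v ℓ hv` (`ReciprocityData.pst` unfolds to it), for consumers that do not
carry a `ReciprocityData`. [cite: FontaineMazurGeometric1995, Conj. 1] [cite: Patrikis2019, Prop. 2.2.1] -/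
theorem exists_eq_weilRep_of_isDeRhamFramed_of_splits {ℓ : ℕ} [Fact ℓ.Prime]
    (hsplit : ∀ v : HeightOneSpectrum (𝓞 K), ((ℓ : ℕ) : 𝓞 K) ∈ v.asIdeal →
      v.asIdeal.ramificationIdx (𝓞 ℚ) = 1 ∧ v.asIdeal.inertiaDeg (𝓞 ℚ) = 1)
    (ι : PadicAlgCl ℓ ≃+* ℂ) (ρ : FramedGaloisRep K (PadicAlgCl ℓ) 1)
    (hdR : ∀ (v : HeightOneSpectrum (𝓞 K)) (hv : ((ℓ : ℕ) : 𝓞 K) ∈ v.asIdeal),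
      (fontainePstAdicCompletion v ℓ hv).IsDeRhamFramed (ρ.toLocal v)) :
    ∃ (θ : HeckeCharacter K) (p q : InfinitePlace K → ℤ) (hinf : θ.HasInfinityType p q)
      (T : Finset (HeightOneSpectrum (𝓞 K))) (e : HeightOneSpectrum (𝓞 K) → ℕ)
      (hmod : HeckeCharacter.IsModulus θ T e), ρ = hinf.weilRep hmod ι := by
  obtain ⟨χ, hχ, h⟩ := FramedGaloisRep.exists_heckeCharacter_of_isDeRhamFramed_of_splits K ℓ hsplit ρ
    hdR ι
  obtain ⟨p, q, hinf⟩ := χ.isAlgebraic_iff_exists_hasInfinityType.mp hχ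
  obtain ⟨T, e, hmod⟩ := χ.exists_isModulus
  exact ⟨χ, p, q, hinf, T, e, hmod,
    eq_weilRep_of_eventually_hasFrobCharpolyAt ι hinf hmod (h.mono fun v hv => hv.2.2)⟩

end SplitPrime

end GLOneRigidity

end Summit.Langlands.Langlands.Theorems

end
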